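import Summits.ValiantsHypothesis.ValiantsHypothesis.Theorems.NewtonUnitEquationsTwoProductsMomentRecordCells

/-!
# R12 rung — RECORD LETTERS ARE FREE, part 3/3: the CLASS COUNT and the laws `momentRecordLawUsed_holds : MomentRecordLawUsed` ((A∘), ✓ `…MomentRecordRungDefs`)
# and `momentRecordLaw_holds : MomentRecordLaw` ((A), ✓ `…MomentRecordDefs`), PROVED
# (crux `NewtonUnitEquations.TwoProducts` = stmt-ValiantsHypothesis-5906; Theorems-side TRANSPLANT of val-idea-37 g4's kernel-proved workfile)

TRANSPLANT NOTE.  Second half of the «CLASS COUNT» section and the audit `example`s of `Cruxes/TwoProducts/RecordLettersFree_val_idea_37_g4.lean`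
rev 4 @432a5af19a71 (sha16 4032ebb8ee1772ab; 0 `sorry`; std axioms; crit-8 VERDICT #17 ★★ / GO 22:36:40Z) VERBATIM BY NAME, namespace `ValIdea37g4` →
`…TwoProducts.MomentRecord`, importing part 2 (`…MomentRecordCells`: cells, record-letter bound) and part 1 (`…MomentRecordLetters`: K2).  Content:
`NegUsedBase`, `cellLetters` / ★ `card_cellLetters_le` (≤ `4m` record letters PER CELL, all weights of the cell at once), `candidates` / `mem_candidates` /
`card_piAntidiag_le` / `card_candidates_le` (supp S ⊆ cell letters, Σ S ≤ m, k ≤ m), ★ `momentRecordCount` (#records ≤ 32(n²+1)·(m+1)²·2^{5m}),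
`arith_bound`, `momentRecordCount_law`, ★★ `momentRecordLawUsed_holds` ((a,b) = (17,2)), ★★ `momentRecordLaw_holds`, `momentRecordLaw_of_lawUsed_holds`,
and the author's audit `example`s pinning the three LANDED statements by FQN.  Desk val-lit g14 RULING #356 (hand val-port-3 g3); `--supports
stmt-ValiantsHypothesis-5906` helper.  ALL CREDIT: val-idea-37 g4 (K2 lever lineage val-idea-34 g5 / 37 g3 / 35 g3; cell template lead c3 `DissocCount`;
rung typing crit-8 W3/W4; Defs crit-8 / val-lit-p3 g17).  HONEST LABEL: the RECORD-LAW rung (A)/(A∘) of R12 in coefficient currency; the CLASS rung (B)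
`ShiftedCarrierLaw` follows by val-lit-p3 g17's transport `Lift.shiftedCarrier_of_lawUsed_holds` (one composition line, separate file); nothing here is
`PlanarCellBound`, the crux 5906 or a summit statement; VP ≠ VNP is NOT proved.
-/

noncomputable section

open Classical

-- single-conjunct layout: Sub = Summit, duplicated namespace component intended
set_option linter.dupNamespace false

namespace Summit.ValiantsHypothesis.ValiantsHypothesis.Theorems.NewtonUnitEquations.TwoProducts.MomentRecord

open scoped BigOperators
open Module Submodule
open Summit.ValiantsHypothesis.ValiantsHypothesis.Theorems.NewtonUnitEquations.TwoProducts.FormalLogLinearisation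

variable {m n : ℕ}

section Count

/-- Used base letters are negative: the first clause of crit-8's `NegWeightUsed` (W4 rev 2/3) — all the count needs. -/
def NegUsedBase (α α' : Fin m → Fin n → ℂ) (x : Fin n → Expo) (ξ : Fin 2 → ℝ) : Prop :=
  ∀ i, ((∃ j, α j i ≠ 0) ∨ ∃ j, α' j i ≠ 0) → wt ξ (x i) < 0

/-- The record letters of a CELL: carriers occurring in some record of some admissible weight of the cell. -/
def cellLetters (α β α' β' : Fin m → Fin n → ℂ) (x : Fin n → Expo) (d : Fin 2 → ℤ) (m' : ℕ)
    (κ : (Bool × Bool × Bool × Bool) × ℕ × Bool) : Finset (Fin n) :=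
  Finset.univ.filter fun a => ∃ ξ : Fin 2 → ℝ, NegUsedBase α α' x ξ ∧ cellOf x ξ = κ ∧
    ∃ (S : Fin n → ℕ) (k : ℕ), IsRecord α β α' β' x d m' ξ (S, k) ∧ 0 < S a

/-- **≤ 4m record letters PER CELL** (uniformly over all weights of the cell and all shallowness-`m'` records). -/
theorem card_cellLetters_le (α β α' β' : Fin m → Fin n → ℂ) (x : Fin n → Expo) (d : Fin 2 → ℤ) (m' : ℕ)
    (κ : (Bool × Bool × Bool × Bool) × ℕ × Bool) : (cellLetters α β α' β' x d m' κ).card ≤ 4 * m := by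
  rcases (cellLetters α β α' β' x d m' κ).eq_empty_or_nonempty with he | ⟨a₀, ha₀⟩
  · rw [he, Finset.card_empty]; exact Nat.zero_le _
  · simp only [cellLetters, Finset.mem_filter, Finset.mem_univ, true_and] at ha₀
    obtain ⟨ξ₀, -, hξ₀, -⟩ := ha₀
    have h := card_le_finrank_of_greedy (k := ℂ) (cost ξ₀ x) (pencilVec α β α' β') (oneVec m)
      (cellLetters α β α' β' x d m' κ) ?_
    · simpa [finrank_pencilSpace] using h
    · intro a ha
      simp only [cellLetters, Finset.mem_filter, Finset.mem_univ, true_and] at ha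
      obtain ⟨ξ, hneg, hξ, S, k, hrec, hSa⟩ := ha
      have hset : {b : Fin n | b ≠ a ∧ cost ξ₀ x b ≤ cost ξ₀ x a} = {b : Fin n | b ≠ a ∧ cost ξ x b ≤ cost ξ x a} := by
        ext b
        simp only [Set.mem_setOf_eq, cost_le_cost_iff_of_cellOf_eq x (hξ₀.trans hξ.symm) a b]
      rw [hset]
      exact weakRecordLemmaUsed_holds m n m' α β α' β' x d ξ S k hneg hrec a hSa

/-- Candidate pairs over a letter set `L`: `S` with `Σ_{L} S = j ≤ m'`, `supp S ⊆ L`, and `k ≤ m'`. -/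
def candidates (L : Finset (Fin n)) (m' : ℕ) : Finset ((Fin n → ℕ) × ℕ) :=
  ((Finset.range (m' + 1)).biUnion fun j => Finset.piAntidiag L j) ×ˢ Finset.range (m' + 1)

/-- A shallow pair supported on `L` is a candidate. -/
theorem mem_candidates {L : Finset (Fin n)} {m' : ℕ} {S : Fin n → ℕ} {k : ℕ} (hS : size S ≤ m') (hk : k ≤ m')
    (hL : ∀ a, S a ≠ 0 → a ∈ L) : (S, k) ∈ candidates L m' := by
  rw [candidates, Finset.mem_product, Finset.mem_biUnion]
  refine ⟨⟨L.sum S, Finset.mem_range.mpr (Nat.lt_succ_of_le ?_), Finset.mem_piAntidiag.mpr ⟨rfl, hL⟩⟩,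
    Finset.mem_range.mpr (Nat.lt_succ_of_le hk)⟩
  calc L.sum S ≤ ∑ i, S i := Finset.sum_le_sum_of_subset (Finset.subset_univ L)
    _ ≤ m' := hS

/-- Stars and bars, crude form: `#piAntidiag L j ≤ 2^(|L| + j)`. -/
theorem card_piAntidiag_le (L : Finset (Fin n)) (j : ℕ) : (Finset.piAntidiag L j).card ≤ 2 ^ (L.card + j) := by
  have h : (L.finsuppAntidiag j).card = (Finset.piAntidiag L j).card := by
    rw [Finset.finsuppAntidiag, Finset.card_map, Finset.card_attach]
  rw [← h, Finset.card_finsuppAntidiag_nat_eq_choose]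
  exact (Nat.choose_le_two_pow _ _).trans (Nat.pow_le_pow_right (by norm_num) (by omega))

/-- Candidate count: `≤ (m+1)² · 2^{5m}` when `|L| ≤ 4m`. -/
theorem card_candidates_le (L : Finset (Fin n)) (m' : ℕ) (hL : L.card ≤ 4 * m') :
    (candidates L m').card ≤ (m' + 1) * 2 ^ (5 * m') * (m' + 1) := by
  rw [candidates, Finset.card_product, Finset.card_range]
  refine Nat.mul_le_mul_right _ ?_
  calc _ ≤ ∑ j ∈ Finset.range (m' + 1), (Finset.piAntidiag L j).card := Finset.card_biUnion_le
    _ ≤ ∑ _j ∈ Finset.range (m' + 1), 2 ^ (5 * m') := Finset.sum_le_sum fun j hj => ?_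
    _ = (m' + 1) * 2 ^ (5 * m') := by rw [Finset.sum_const, Finset.card_range, smul_eq_mul]
  have hj := Finset.mem_range.mp hj
  exact (card_piAntidiag_le L j).trans (Nat.pow_le_pow_right (by norm_num) (by omega))

/-- **THE CLASS COUNT.** Records over weights negative on the used base letters number
`≤ 32 (n² + 1) · (m+1)² 2^{5m}` — no sparsity, no dissociation, no orientation hypothesis. -/
theorem momentRecordCount (m n : ℕ) (α β α' β' : Fin m → Fin n → ℂ) (x : Fin n → Expo) (d : Fin 2 → ℤ) :
    ((shallowPairs n m).filter fun p => ∃ ξ : Fin 2 → ℝ, NegUsedBase α α' x ξ ∧ IsRecord α β α' β' x d m ξ p).card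
      ≤ 32 * (n ^ 2 + 1) * ((m + 1) * 2 ^ (5 * m) * (m + 1)) := by
  calc _ ≤ ((cellSet x).biUnion fun κ => candidates (cellLetters α β α' β' x d m κ) m).card :=
        Finset.card_le_card ?_
    _ ≤ ∑ κ ∈ cellSet x, (candidates (cellLetters α β α' β' x d m κ) m).card := Finset.card_biUnion_le
    _ ≤ ∑ _κ ∈ cellSet x, (m + 1) * 2 ^ (5 * m) * (m + 1) :=
        Finset.sum_le_sum fun κ _ => card_candidates_le _ _ (card_cellLetters_le α β α' β' x d m κ)
    _ = (cellSet x).card * ((m + 1) * 2 ^ (5 * m) * (m + 1)) := by rw [Finset.sum_const, smul_eq_mul]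
    _ ≤ 32 * (n ^ 2 + 1) * ((m + 1) * 2 ^ (5 * m) * (m + 1)) := Nat.mul_le_mul_right _ (card_cellSet_le x)
  rintro ⟨S, k⟩ hp
  rw [Finset.mem_filter] at hp
  obtain ⟨-, ξ, hneg, hrec⟩ := hp
  rw [Finset.mem_biUnion]
  refine ⟨cellOf x ξ, cellOf_mem_cellSet x ξ, ?_⟩
  have hlive := hrec.1
  simp only [live, Set.mem_setOf_eq] at hlive
  obtain ⟨hsize, hk, -⟩ := hlive
  refine mem_candidates hsize (hk.trans hsize) fun a ha => ?_
  simp only [cellLetters, Finset.mem_filter, Finset.mem_univ, true_and]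
  exact ⟨ξ, hneg, rfl, S, k, hrec, Nat.pos_of_ne_zero ha⟩

/-- Lazy arithmetic: `32 (n²+1) (m+1)² 2^{5m} ≤ 2^{17m} (t+2)²` for `1 ≤ m`, `n ≤ 2mt`. -/
theorem arith_bound (m n t : ℕ) (hm : 1 ≤ m) (hn : n ≤ 2 * m * t) :
    32 * (n ^ 2 + 1) * ((m + 1) * 2 ^ (5 * m) * (m + 1)) ≤ 2 ^ (17 * m) * (t + 2) ^ 2 := by
  obtain ⟨X, hX⟩ : ∃ X : ℕ, X = 2 ^ m := ⟨_, rfl⟩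
  have hmX : m + 1 ≤ X := hX ▸ Nat.lt_two_pow_self
  have hX2 : 2 ≤ X := by
    rw [hX]
    calc (2 : ℕ) = 2 ^ 1 := (pow_one 2).symm
      _ ≤ 2 ^ m := Nat.pow_le_pow_right (by norm_num) hm
  have hX0 : 0 < X := by omega
  have hn' : n ≤ 2 * X * (t + 2) := by
    calc n ≤ 2 * m * t := hn
      _ ≤ 2 * X * (t + 2) := Nat.mul_le_mul (Nat.mul_le_mul_left 2 (by omega)) (by omega)
  have h5 : 2 ^ (5 * m) = X ^ 5 := by rw [hX, ← pow_mul, mul_comm]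
  have h17 : 2 ^ (17 * m) = X ^ 17 := by rw [hX, ← pow_mul, mul_comm]
  rw [h5, h17]
  have hA : n ^ 2 + 1 ≤ (2 * X * (t + 2)) ^ 2 + X ^ 2 * (t + 2) ^ 2 :=
    Nat.add_le_add (Nat.pow_le_pow_left hn' 2) (mul_pos (pow_pos hX0 2) (pow_pos (by omega) 2))
  have hB : (m + 1) * X ^ 5 * (m + 1) ≤ X * X ^ 5 * X := Nat.mul_le_mul (Nat.mul_le_mul_right _ hmX) hmX
  have h160 : 160 ≤ X ^ 8 :=
    calc 160 ≤ 2 ^ 8 := by norm_num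
      _ ≤ X ^ 8 := Nat.pow_le_pow_left hX2 8
  calc 32 * (n ^ 2 + 1) * ((m + 1) * X ^ 5 * (m + 1))
      ≤ 32 * ((2 * X * (t + 2)) ^ 2 + X ^ 2 * (t + 2) ^ 2) * (X * X ^ 5 * X) :=
        Nat.mul_le_mul (Nat.mul_le_mul_left _ hA) hB
    _ = 160 * (X ^ 9 * (t + 2) ^ 2) := by ring
    _ ≤ X ^ 8 * (X ^ 9 * (t + 2) ^ 2) := Nat.mul_le_mul_right _ h160
    _ = X ^ 17 * (t + 2) ^ 2 := by ring

/-- The law-shaped bound behind (A) and (A∘). -/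
theorem momentRecordCount_law (m n t : ℕ) (α β α' β' : Fin m → Fin n → ℂ) (x : Fin n → Expo) (d : Fin 2 → ℤ)
    (hn : n ≤ 2 * m * t) :
    ((shallowPairs n m).filter fun p => ∃ ξ : Fin 2 → ℝ, NegUsedBase α α' x ξ ∧ IsRecord α β α' β' x d m ξ p).card
      ≤ 2 ^ (17 * m) * (t + 2) ^ 2 := by
  rcases Nat.eq_zero_or_pos m with rfl | hm
  · have hn0 : n = 0 := by omega
    subst hn0
    calc _ ≤ (shallowPairs 0 0).card := Finset.card_filter_le _ _
      _ = 1 := by simp [shallowPairs]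
      _ ≤ 2 ^ (17 * 0) * (t + 2) ^ 2 := Nat.one_le_iff_ne_zero.mpr (by positivity)
  · exact (momentRecordCount m n α β α' β' x d).trans (arith_bound m n t hm hn)

/-- **(A∘) = THE LANDED RUNG STATEMENT OF RECORD `MomentRecordLawUsed` (✓ `…MomentRecordRungDefs`, crit-8 W4) PROVED**
(with `(a, b) = (17, 2)`; only the first clause of `NegWeightUsed` is used). -/
theorem momentRecordLawUsed_holds : MomentRecordLawUsed := by
  refine ⟨17, 2, fun m n t α β α' β' x d _ hn => ?_⟩
  refine (Finset.card_le_card ?_).trans (momentRecordCount_law m n t α β α' β' x d hn)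
  intro p hp
  rw [Finset.mem_filter] at hp ⊢
  obtain ⟨hp, ξ, hξ, hrec⟩ := hp
  exact ⟨hp, ξ, fun i h => (hξ i).1 h, hrec⟩

/-- **THE LANDED (A) `MomentRecordLaw` PROVED** (with `(a, b) = (17, 2)`; its hypotheses `TermSparse`, `CarrierDissociated` are not used). -/
theorem momentRecordLaw_holds : MomentRecordLaw := by
  refine ⟨17, 2, fun m n t α β α' β' x d _ _ _ hn _ => ?_⟩
  refine (Finset.card_le_card ?_).trans (momentRecordCount_law m n t α β α' β' x d hn)
  intro p hp
  rw [Finset.mem_filter] at hp ⊢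
  obtain ⟨hp, ξ, hξ, hrec⟩ := hp
  exact ⟨hp, ξ, fun i _ => (hξ i).1, hrec⟩

/-- the typed glue target `momentRecordLaw_of_lawUsed` of the RungDefs, discharged (trivially, given the above). -/
theorem momentRecordLaw_of_lawUsed_holds : momentRecordLaw_of_lawUsed := fun _ => momentRecordLaw_holds

end Count

/-! ## Audit: the landed statements, by their tree names, are inhabited by this file's theorems. -/
example : Summit.ValiantsHypothesis.ValiantsHypothesis.Theorems.NewtonUnitEquations.TwoProducts.MomentRecord.MomentRecordLaw :=
  momentRecordLaw_holds
example : Summit.ValiantsHypothesis.ValiantsHypothesis.Theorems.NewtonUnitEquations.TwoProducts.MomentRecord.MomentRecordLawUsed :=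
  momentRecordLawUsed_holds
example : Summit.ValiantsHypothesis.ValiantsHypothesis.Theorems.NewtonUnitEquations.TwoProducts.MomentRecord.momentRecordLaw_of_lawUsed :=
  momentRecordLaw_of_lawUsed_holds

end Summit.ValiantsHypothesis.ValiantsHypothesis.Theorems.NewtonUnitEquations.TwoProducts.MomentRecord
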